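import Summits.KontsevichZagierPeriods.KontsevichZagierPeriods.Theorems.HurwitzMicroSectorsNormalFormPrincipleAlgDlogMoves
import Summits.KontsevichZagierPeriods.KontsevichZagierPeriods.Theorems.HurwitzMicroSectorsNormalFormPrincipleDlogMoves
import Summits.KontsevichZagierPeriods.KontsevichZagierPeriods.Theorems.HurwitzMicroSectorsNormalFormPrincipleSplitMoves

/-!
# `NormalFormPrinciple` (stmt-KontsevichZagierPeriods-3869), stub `box_algsplit_mem_relations` —
# siege attempt k6 (explicit / elementary route), III: point representations and carriers over `K`

Pure proof file, no definitions. `K ⊆ ℝ` is an intermediate field of real ALGEBRAIC numbers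
(hypothesis `hK`). Work in `Q = FormalRep ⧸ relations`. Two families of representations, taken
as hypotheses with their specification (discharged by `exists_ptK`, `exists_carrierK`):

* point representations `Z r = [pt, r]` (`r ∈ K`) over `ℝ⁰`: `r ↦ ⟦Z r⟧` is additive, value `r`;
* **carriers** `Λ u d = [(1,u), d/y]` (`u, d ∈ K`): `⟦Λ u d⟧ = 0` for `u ≤ 1`, `d ↦ ⟦Λ u d⟧` is
  additive, and — the engine of the explicit route — **multiplicativity in `u ≥ 1`**:
  `⟦Λ (uv) d⟧ = ⟦Λ u d⟧ + ⟦Λ v d⟧` (split `(1, uv)` at `u`, rescale `(u, uv)` by `1/u`; rules 1, 2),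
  whence products, powers and EXACT MONOMIALS with integer exponents
  (`carrier_mk_monomial`: `u = ∏ₗ εₗ^{nₗ}` ⇒ `⟦Λ u d⟧ = Σₗ nₗ • ⟦Λ εₗ d⟧`, negative exponents cleared
  by multiplying through, never dividing); value `d log u`.

Sources: M. Kontsevich, D. Zagier, *Periods* (2001), §1.1 (`log 2 = ∫₁² dx/x`), §1.2 rules (1), (2).
-/

noncomputable section

open MeasureTheory Set Finset
open Literature.NumberTheory.Transcendental Literature.NumberTheory.Transcendental.KZ
open Literature.ModelTheory.ExponentialFields (IsSemialgebraic isSemialgebraic_univ)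

namespace Summit.KontsevichZagierPeriods.HurwitzMicroSectors.NormalFormPrinciple.PiBox.SiegeK6

open Summit.KontsevichZagierPeriods.HurwitzMicroSectors.NormalFormPrinciple.PiBox.Dlog
  (exists_dlogA value_dlogA dlogA_scale_mem_relations dlogA_merge_mem_relations
    dlogA_zero_mem_relations split_mem_relations slab_empty_mem_relations pt_add_mem_relations
    pt_zero_mem_relations value_pt)

variable {K : IntermediateField ℚ ℝ}

/-! ## Classes modulo relations -/

/-- `x − y ∈ relations` as an identity of classes. [folklore] -/
theorem mk_eq_mk_of_sub_mem {x y : FormalRep} (h : x - y ∈ relations) :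
    (x : FormalRep ⧸ relations) = y :=
  QuotientAddGroup.eq_iff_sub_mem.mpr h

/-- `x − y − z ∈ relations` as an identity of classes. [folklore] -/
theorem mk_eq_add_of_sub_sub_mem {x y z : FormalRep} (h : x - y - z ∈ relations) :
    (x : FormalRep ⧸ relations) = y + z := by
  rw [← QuotientAddGroup.mk_add]
  exact mk_eq_mk_of_sub_mem (by rwa [sub_add_eq_sub_sub])

/-- A relation has class `0`. [folklore] -/
theorem mk_eq_zero_of_mem {x : FormalRep} (h : x ∈ relations) : (x : FormalRep ⧸ relations) = 0 :=
  (QuotientAddGroup.eq_zero_iff x).mpr h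

/-! ## The two families -/

/-- **Point representations over `K`**: `Z r = [pt, r]`, `r ∈ K` (a real algebraic constant is a
`ℚ`-semialgebraic function). [cite: KontsevichZagier2001, §1.1] -/
theorem exists_ptK (hK : ∀ c : K, IsAlgebraic ℚ (c : ℝ)) :
    ∃ Z : K → IntegralRep 0, ∀ r, (Z r).domain = univ ∧ (Z r).integrand = fun _ => (r:ℝ) :=
  ⟨fun r =>
    { domain := univ
      integrand := fun _ => (r:ℝ)
      isSemialgebraic_domain := isSemialgebraic_univ
      isSemialgebraicFunOn_integrand :=
        isSemialgebraicFunOn_const_of_isAlgebraic isSemialgebraic_univ (hK r)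
      integrableOn := integrableOn_const (hs := by simp [volume_univ_fin_zero]) },
    fun _ => ⟨rfl, rfl⟩⟩

/-- **Carriers over `K`**: `Λ u d = [(1,u), d/y]`, `u, d ∈ K`. [cite: KontsevichZagier2001, §1.1] -/
theorem exists_carrierK (hK : ∀ c : K, IsAlgebraic ℚ (c : ℝ)) :
    ∃ Λ : K → K → IntegralRep 1, ∀ u d, (Λ u d).domain = {x | x 0 ∈ Set.Ioo (1:ℝ) u} ∧
      (Λ u d).integrand = fun x => (d:ℝ) / x 0 := by
  have h : ∀ u d : K, ∃ L : IntegralRep 1, L.domain = {x | x 0 ∈ Set.Ioo (1:ℝ) u} ∧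
      L.integrand = fun x => (d:ℝ) / x 0 := fun u d =>
    exists_dlogA isAlgebraic_one (hK u) (hK d) one_pos
  choose Λ hΛ using h
  exact ⟨Λ, hΛ⟩

section Families

variable {Z : K → IntegralRep 0} {Λ : K → K → IntegralRep 1}

/-! ## Point representations -/

/-- Additivity of point classes: `⟦Z (r + r')⟧ = ⟦Z r⟧ + ⟦Z r'⟧`. [cite: KontsevichZagier2001, §1.2 rule (1)] -/
theorem pt_mk_add (hZ : ∀ r, (Z r).domain = univ ∧ (Z r).integrand = fun _ => (r:ℝ)) (r r' : K) :
    ((of (Z (r + r')) : FormalRep) : FormalRep ⧸ relations) = (of (Z r) : FormalRep) + (of (Z r') : FormalRep) :=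
  mk_eq_add_of_sub_sub_mem (pt_add_mem_relations _ _ _ (hZ _).1 (hZ _).1 (hZ _).1
    (by rw [(hZ _).2]; push_cast; rfl) (hZ _).2 (hZ _).2)

/-- `⟦Z 0⟧ = 0`. [cite: KontsevichZagier2001, §1.2 rule (1)] -/
theorem pt_mk_zero (hZ : ∀ r, (Z r).domain = univ ∧ (Z r).integrand = fun _ => (r:ℝ)) :
    ((of (Z 0) : FormalRep) : FormalRep ⧸ relations) = 0 :=
  mk_eq_zero_of_mem (pt_zero_mem_relations _ (by rw [(hZ 0).2]; push_cast; rfl))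

/-- Finite additivity of point classes. [cite: KontsevichZagier2001, §1.2 rule (1)] -/
theorem pt_mk_sum (hZ : ∀ r, (Z r).domain = univ ∧ (Z r).integrand = fun _ => (r:ℝ)) {ι : Type*}
    (s : Finset ι) (r : ι → K) :
    ((of (Z (∑ i ∈ s, r i)) : FormalRep) : FormalRep ⧸ relations) =
      ∑ i ∈ s, ((of (Z (r i)) : FormalRep) : FormalRep ⧸ relations) := by
  classical
  induction s using Finset.induction_on with
  | empty => simpa using pt_mk_zero hZ
  | insert a s ha ih => rw [Finset.sum_insert ha, Finset.sum_insert ha, pt_mk_add hZ, ih]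

/-- Value of a point representation: `[pt, r]` represents `r`. [cite: KontsevichZagier2001, §1.1] -/
theorem value_ptK (hZ : ∀ r, (Z r).domain = univ ∧ (Z r).integrand = fun _ => (r:ℝ)) (r : K) :
    (Z r).value = r :=
  value_pt _ (hZ r).1 (hZ r).2

/-! ## Carriers: the easy identities -/

/-- An empty carrier: `⟦Λ u d⟧ = 0` for `u ≤ 1`. [cite: KontsevichZagier2001, §1.2 rule (1)] -/
theorem carrier_mk_of_le_one
    (hΛ : ∀ u d, (Λ u d).domain = {x | x 0 ∈ Set.Ioo (1:ℝ) u} ∧ (Λ u d).integrand = fun x => (d:ℝ) / x 0)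
    {u : K} (hu : (u:ℝ) ≤ 1) (d : K) : ((of (Λ u d) : FormalRep) : FormalRep ⧸ relations) = 0 :=
  mk_eq_zero_of_mem (slab_empty_mem_relations _ (hΛ u d).1 hu)

/-- `⟦Λ u 0⟧ = 0`. [cite: KontsevichZagier2001, §1.2 rule (1)] -/
theorem carrier_mk_zero
    (hΛ : ∀ u d, (Λ u d).domain = {x | x 0 ∈ Set.Ioo (1:ℝ) u} ∧ (Λ u d).integrand = fun x => (d:ℝ) / x 0)
    (u : K) : ((of (Λ u 0) : FormalRep) : FormalRep ⧸ relations) = 0 :=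
  mk_eq_zero_of_mem (dlogA_zero_mem_relations _ (by rw [(hΛ u 0).2]; push_cast; exact fun _ _ => rfl))

/-- Additivity in the numerator: `⟦Λ u (d + d')⟧ = ⟦Λ u d⟧ + ⟦Λ u d'⟧` (merging, rule 1).
[cite: KontsevichZagier2001, §1.2 rule (1)] -/
theorem carrier_mk_add
    (hΛ : ∀ u d, (Λ u d).domain = {x | x 0 ∈ Set.Ioo (1:ℝ) u} ∧ (Λ u d).integrand = fun x => (d:ℝ) / x 0)
    (u d d' : K) :
    ((of (Λ u (d + d')) : FormalRep) : FormalRep ⧸ relations) =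
      (of (Λ u d) : FormalRep) + (of (Λ u d') : FormalRep) :=
  mk_eq_add_of_sub_sub_mem (dlogA_merge_mem_relations _ _ _ (hΛ u _).1 (hΛ u _).1 (hΛ u _).1
    (by rw [(hΛ u _).2]; push_cast; exact fun _ _ => rfl)
    (by rw [(hΛ u _).2]; exact fun _ _ => rfl) (by rw [(hΛ u _).2]; exact fun _ _ => rfl))

/-- `ℤ`-linearity in the numerator: `⟦Λ u (Σᵢ nᵢ • dᵢ)⟧ = Σᵢ nᵢ • ⟦Λ u dᵢ⟧`.
[cite: KontsevichZagier2001, §1.2 rule (1)] -/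
theorem carrier_mk_sum_zsmul
    (hΛ : ∀ u d, (Λ u d).domain = {x | x 0 ∈ Set.Ioo (1:ℝ) u} ∧ (Λ u d).integrand = fun x => (d:ℝ) / x 0)
    (u : K) {ι : Type*} (s : Finset ι) (n : ι → ℤ) (d : ι → K) :
    ((of (Λ u (∑ i ∈ s, n i • d i)) : FormalRep) : FormalRep ⧸ relations) =
      ∑ i ∈ s, n i • ((of (Λ u (d i)) : FormalRep) : FormalRep ⧸ relations) := by
  let φ : K →+ FormalRep ⧸ relations :=
    { toFun := fun d => ((of (Λ u d) : FormalRep) : FormalRep ⧸ relations)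
      map_zero' := carrier_mk_zero hΛ u
      map_add' := carrier_mk_add hΛ u }
  change φ (∑ i ∈ s, n i • d i) = ∑ i ∈ s, n i • φ (d i)
  simp only [map_sum, map_zsmul]

/-- Value of a carrier: `∫_{(1,u)} d/y dy = d log u` for `u ≥ 1`. [cite: KontsevichZagier2001, §1.1] -/
theorem value_carrierK
    (hΛ : ∀ u d, (Λ u d).domain = {x | x 0 ∈ Set.Ioo (1:ℝ) u} ∧ (Λ u d).integrand = fun x => (d:ℝ) / x 0)
    {u : K} (hu : 1 ≤ (u:ℝ)) (d : K) : (Λ u d).value = d * Real.log u := by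
  rw [value_dlogA (Λ u d) (hΛ u d).1 (by rw [(hΛ u d).2]; exact fun _ _ => rfl) one_pos hu, div_one]

/-! ## Carriers: multiplicativity -/

/-- **Multiplicativity of carriers.** For `u, v ≥ 1` in `K`: `⟦Λ (uv) d⟧ = ⟦Λ u d⟧ + ⟦Λ v d⟧` —
split `(1, uv)` at `u` (rule 1 and a null point), rescale `(u, uv)` by `1/u` onto `(1, v)` (rule 2).
[cite: KontsevichZagier2001, §1.2 rules (1), (2)] -/
theorem carrier_mk_mul (hK : ∀ c : K, IsAlgebraic ℚ (c : ℝ))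
    (hΛ : ∀ u d, (Λ u d).domain = {x | x 0 ∈ Set.Ioo (1:ℝ) u} ∧ (Λ u d).integrand = fun x => (d:ℝ) / x 0)
    {u v : K} (hu : 1 ≤ (u:ℝ)) (hv : 1 ≤ (v:ℝ)) (d : K) :
    ((of (Λ (u * v) d) : FormalRep) : FormalRep ⧸ relations) =
      (of (Λ u d) : FormalRep) + (of (Λ v d) : FormalRep) := by
  have hu0 : (0:ℝ) < u := lt_of_lt_of_le one_pos hu
  -- the middle piece `M = [(u, uv), d/y]`
  obtain ⟨M, hMd, hMi⟩ := exists_dlogA (hK u) (hK (u * v)) (hK d) hu0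
  have hsplit : of (Λ (u * v) d) - of (Λ u d) - of M ∈ relations := by
    refine split_mem_relations _ _ _ (by rw [(hΛ _ d).1, MulMemClass.coe_mul]) (hΛ u d).1 hMd hu ?_
      (by rw [(hΛ u d).2, (hΛ _ d).2]; exact fun _ _ => rfl)
      (by rw [hMi, (hΛ _ d).2]; exact fun _ _ => rfl)
    push_cast
    exact le_mul_of_one_le_right hu0.le hv
  have hscale : of (Λ v d) - of M ∈ relations := by
    refine dlogA_scale_mem_relations (s := (u:ℝ)) (hK u) (Λ v d) M (hΛ v d).1 ?_
      (by rw [(hΛ v d).2]; exact fun _ _ => rfl) (by rw [hMi]; exact fun _ _ => rfl) one_pos hu0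
    rw [hMd, mul_one, MulMemClass.coe_mul]
  have h : of (Λ (u * v) d) - of (Λ u d) - of (Λ v d) =
      (of (Λ (u * v) d) - of (Λ u d) - of M) - (of (Λ v d) - of M) := by abel
  exact mk_eq_add_of_sub_sub_mem (h ▸ relations.sub_mem hsplit hscale)

/-- Products: `⟦Λ (∏ᵢ xᵢ) d⟧ = Σᵢ ⟦Λ xᵢ d⟧` for `xᵢ ≥ 1`. [cite: KontsevichZagier2001, §1.2] -/
theorem carrier_mk_prod (hK : ∀ c : K, IsAlgebraic ℚ (c : ℝ))
    (hΛ : ∀ u d, (Λ u d).domain = {x | x 0 ∈ Set.Ioo (1:ℝ) u} ∧ (Λ u d).integrand = fun x => (d:ℝ) / x 0)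
    {ι : Type*} (s : Finset ι) (x : ι → K) (hx : ∀ i ∈ s, 1 ≤ (x i : ℝ)) (d : K) :
    ((of (Λ (∏ i ∈ s, x i) d) : FormalRep) : FormalRep ⧸ relations) =
      ∑ i ∈ s, ((of (Λ (x i) d) : FormalRep) : FormalRep ⧸ relations) := by
  classical
  induction s using Finset.induction_on with
  | empty => simpa using carrier_mk_of_le_one hΛ (u := 1) (by push_cast; exact le_rfl) d
  | insert a s ha ih =>
    have hs1 : 1 ≤ ((∏ i ∈ s, x i : K) : ℝ) := by
      push_cast
      exact Finset.prod_induction _ (fun t : ℝ => 1 ≤ t) (fun a b ha hb => one_le_mul_of_one_le_of_one_le ha hb)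
        le_rfl fun i hi => hx i (Finset.mem_insert_of_mem hi)
    rw [Finset.prod_insert ha, Finset.sum_insert ha,
      carrier_mk_mul hK hΛ (hx a (Finset.mem_insert_self a s)) hs1 d,
      ih fun i hi => hx i (Finset.mem_insert_of_mem hi)]

/-- Powers: `⟦Λ (x^n) d⟧ = n • ⟦Λ x d⟧` for `x ≥ 1`. [cite: KontsevichZagier2001, §1.2] -/
theorem carrier_mk_pow (hK : ∀ c : K, IsAlgebraic ℚ (c : ℝ))
    (hΛ : ∀ u d, (Λ u d).domain = {x | x 0 ∈ Set.Ioo (1:ℝ) u} ∧ (Λ u d).integrand = fun x => (d:ℝ) / x 0)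
    {x : K} (hx : 1 ≤ (x:ℝ)) (n : ℕ) (d : K) :
    ((of (Λ (x ^ n) d) : FormalRep) : FormalRep ⧸ relations) =
      n • ((of (Λ x d) : FormalRep) : FormalRep ⧸ relations) := by
  induction n with
  | zero => simpa using carrier_mk_of_le_one hΛ (u := 1) (by push_cast; exact le_rfl) d
  | succ n ih =>
    have hxn : 1 ≤ ((x ^ n : K) : ℝ) := by push_cast; exact one_le_pow₀ hx
    rw [pow_succ, carrier_mk_mul hK hΛ hxn hx d, ih, succ_nsmul]

/-- **Exact monomials.** If `u = ∏ₗ εₗ^{nₗ}` (integer exponents, `εₗ ≥ 1`, `u ≥ 1`, all in `K`) then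
`⟦Λ u d⟧ = Σₗ nₗ • ⟦Λ εₗ d⟧`: clear the negative exponents — `u · ∏ₗ εₗ^{nₗ⁻} = ∏ₗ εₗ^{nₗ⁺}` — and use
multiplicativity on both sides (no division in `Q`). [cite: KontsevichZagier2001, §1.2] -/
theorem carrier_mk_monomial {K : IntermediateField ℚ ℝ} {Λ : K → K → IntegralRep 1}
    (hK : ∀ c : K, IsAlgebraic ℚ (c : ℝ))
    (hΛ : ∀ u d, (Λ u d).domain = {x | x 0 ∈ Set.Ioo (1:ℝ) u} ∧ (Λ u d).integrand = fun x => (d:ℝ) / x 0)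
    {s : ℕ} (ε : Fin s → K) (hε : ∀ l, 1 ≤ (ε l : ℝ)) (n : Fin s → ℤ) {u : K} (hu1 : 1 ≤ (u:ℝ))
    (hu : (u:ℝ) = ∏ l, (ε l : ℝ) ^ n l) (d : K) :
    ((of (Λ u d) : FormalRep) : FormalRep ⧸ relations) =
      ∑ l, n l • ((of (Λ (ε l) d) : FormalRep) : FormalRep ⧸ relations) := by
  -- positive and negative parts of the exponents
  set A : K := ∏ l, ε l ^ (n l).toNat with hA
  set B : K := ∏ l, ε l ^ (-n l).toNat with hB
  have hε0 : ∀ l, (ε l : ℝ) ≠ 0 := fun l => (lt_of_lt_of_le one_pos (hε l)).ne'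
  have huB : u * B = A := by
    apply Subtype.ext
    rw [hA, hB]
    push_cast
    rw [hu, ← Finset.prod_mul_distrib]
    refine Finset.prod_congr rfl fun l _ => ?_
    rw [← zpow_natCast, ← zpow_natCast, ← zpow_add₀ (hε0 l)]
    congr 1
    have := Int.toNat_sub_toNat_neg (n l)
    linarith
  have hB1 : 1 ≤ (B:ℝ) := by
    rw [hB]
    push_cast
    exact Finset.prod_induction _ (fun t : ℝ => 1 ≤ t) (fun a b ha hb => one_le_mul_of_one_le_of_one_le ha hb)
      le_rfl fun l _ => one_le_pow₀ (hε l)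
  have hmul := carrier_mk_mul hK hΛ hu1 hB1 d
  rw [huB, hA, carrier_mk_prod hK hΛ _ _ (fun l _ => by push_cast; exact one_le_pow₀ (hε l)) d] at hmul
  rw [hB, carrier_mk_prod hK hΛ _ _ (fun l _ => by push_cast; exact one_le_pow₀ (hε l)) d] at hmul
  simp only [carrier_mk_pow hK hΛ (hε _)] at hmul
  rw [eq_sub_of_add_eq hmul.symm, ← Finset.sum_sub_distrib]
  refine Finset.sum_congr rfl fun l _ => ?_
  rw [← natCast_zsmul, ← natCast_zsmul]
  conv_rhs => rw [← Int.toNat_sub_toNat_neg (n l), sub_zsmul]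
  rw [sub_eq_add_neg]

end Families

end Summit.KontsevichZagierPeriods.HurwitzMicroSectors.NormalFormPrinciple.PiBox.SiegeK6
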